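import Summits.QuantumAdvantage.QuantumAdvantage.Theorems.CubicForrelationNearExactIsExactTwelveLevelSixLt

/-!
# Crux `CubicForrelation.NearExactIsExact` (stmt-QuantumAdvantage-14043) — n = 12, level ≥ 6 AT `Φ = 59/64`: the branch "`8 ∣ e` off the
  9-flat" (gen 13's engine `tw6_levelSix_lt` with the closed budget `Σ e² ≤ 640`)

Certificate seat `b2b-cforr-cert` (gen 15).  HONEST FRAMING: a lemma (standard axioms) about cubic Boolean pairs on 12 bits — one sub-branch of
"is `59/64` attained at `n = 12`?"; finite-slice statement, NOT summit progress.

`tw15_levelSix_eight_false`: cubic `f, g`, `W_g = 64u''`, residual `e = u'' − (−1)^f` with `Σ e² ≤ 640`, `Z = {u'' even} = x_Z ⊕ V₀` a 9-flat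
(`#V₀ = 512`), and `8 ∣ e` off `Z`.  Contradiction, verbatim by gen 13's chain: (H3)/(H4) (`tw6_H34_tol`), the sign `σ ≡ e (mod 4)` is quadratic
along `Z` (`fr_hsd`), its 4-flat sums are `≡ 4·Pf (mod 8)` (`ws_sum4_mod8`), the odd set of the wild part `λ = (e − σ)/4` has `≤ 16 < 32`
points so every 4-flat sum of `λ` is even (covering), hence `λ` is even on `Z` (`ws_erm_round`), and the ENGINE (`fl1_flat_l1`, `fl1_pairing`):
`Σ_Z σu'' ≤ 128` against `Σ_Z σu'' ≥ 192 − (1/8)Σ_{∉Z}e² − (1/3)Σ_Z(e²−1) > 149`.  The tree's `tw6_levelSix_lt` had `Σ e² < 640` and derived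
`8 ∣ e` off `Z` itself; at `Σ e² = 640` that derivation has exceptions (`tw15_off_flat_le128`), treated elsewhere (`tw15_levelSix_sparse_false`).

References: Ax (1964) / McEliece (1972); Hou (1998); MacWilliams–Sloane (1977) Ch. 13–15; Carlet (2021) §5.2; O'Donnell (2014) §3.3.
Everything below is proved from Mathlib and the tree; axioms are the standard three.
-/

set_option linter.dupNamespace false -- D-0017: single-problem summit ⇒ `QuantumAdvantage.QuantumAdvantage` by design

noncomputable section

namespace Summit.QuantumAdvantage.QuantumAdvantage.Theorems.CubicForrelation.NearExactIsExact

open Finset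
open Literature.Computability.QuantumComplexity
open Literature.Computability.QuantumComplexity.BuzetChailloux (bxor zeroVec bxor_bxor_cancel_left bxor_zeroVec zeroVec_bxor bxor_comm
  bxor_self)
open Literature.Computability.QuantumComplexity.DerivativeWalsh (W)

/-! ### The branch `8 ∣ e` off `Z` at budget `≤ 640` -/

/-- **Level `≥ 6`, `8 ∣ e` off the 9-flat, budget `≤ 640`: impossible** (gen 13's engine with the closed budget).  See the module docstring.
[this work] -/
theorem tw15_levelSix_eight_false (f g : (Fin (6 + 6) → Bool) → Bool) (hf : IsDegLeFun 3 f) (hg : IsDegLeFun 3 g)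
    (u'' : (Fin (6 + 6) → Bool) → ℤ) (hu'' : ∀ x, W (fun y => signOf (g y)) x = (2 : ℝ) ^ 6 * (u'' x : ℝ))
    (hB_le : (∑ x, (u'' x - sZ (f x)) ^ 2 : ℤ) ≤ 640)
    (V₀ : Finset (Fin (6 + 6) → Bool)) (xZ : Fin (6 + 6) → Bool) (h0 : zeroVec ∈ V₀)
    (hadd : ∀ a ∈ V₀, ∀ b ∈ V₀, bxor a b ∈ V₀) (hcardV : #V₀ = 512)
    (hS : (univ.filter fun x : Fin (6 + 6) → Bool => ¬ Odd (u'' x)) = V₀.image (bxor xZ))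
    (hoff8 : ∀ y, y ∉ (univ.filter fun x : Fin (6 + 6) → Bool => ¬ Odd (u'' x)) → (8 : ℤ) ∣ u'' y - sZ (f y)) : False := by
  classical
  -- `u = 4u''` at the Ax level `4`
  set u : (Fin (6 + 6) → Bool) → ℤ := fun x => 4 * u'' x with hudef
  have hu : ∀ x, W (fun y => signOf (g y)) x = (2 : ℝ) ^ 4 * (u x : ℝ) := by
    intro x; rw [hu'' x]; simp only [u]; push_cast; ring
  set e : (Fin (6 + 6) → Bool) → ℤ := fun x => u'' x - sZ (f x) with hedef
  change (∑ x, e x ^ 2 : ℤ) ≤ 640 at hB_le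
  have hFe : ∀ y, u y - 4 * sZ (f y) = 4 * e y := fun y => by simp only [u, e]; ring
  set Z := univ.filter (fun x : Fin (6 + 6) → Bool => ¬ Odd (u'' x)) with hZdef
  have hmemZ : ∀ x, x ∈ Z ↔ ¬ Odd (u'' x) := fun x => by simp [hZdef]
  change ∀ y, y ∉ Z → (8 : ℤ) ∣ e y at hoff8
  have heodd : ∀ x, x ∈ Z → Odd (e x) := by
    intro x hx
    have hev := Int.not_odd_iff_even.1 ((hmemZ x).1 hx)
    rcases tp_sZ_cases (f x) with hs | hs <;> simp only [e] <;> rw [hs]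
    · exact Int.odd_sub.2 (iff_of_false (Int.not_odd_iff_even.2 hev) (by decide))
    · exact Int.odd_sub.2 (iff_of_false (Int.not_odd_iff_even.2 hev) (by decide))
  have hsq1 : ∀ x, x ∈ Z → 1 ≤ e x ^ 2 := by
    intro x hx
    have h0 := Int.odd_iff.1 (heodd x hx)
    have : e x ≤ -1 ∨ 1 ≤ e x := by omega
    have := tp_sq_ge (k := 1) (by norm_num) this
    linarith
  have hsplit : (∑ x, e x ^ 2 : ℤ) = ∑ x ∈ Z, e x ^ 2 + ∑ x ∈ univ.filter (fun x => x ∉ Z), e x ^ 2 := by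
    rw [← sum_filter_add_sum_filter_not univ (fun x => x ∈ Z)]
    congr 1
    exact sum_congr (by ext x; simp) fun _ _ => rfl
  -- Parseval at level 6: `Σ u''² = 4096`
  have hpar : ∑ x, u'' x ^ 2 = 4096 := by
    have h := zms_sum_u_sq 2 g u (fun x => (hu x).trans (by norm_num))
    have e : ∑ x, ((u x : ℝ)) ^ 2 = 16 * ∑ x, ((u'' x : ℝ)) ^ 2 := by
      rw [mul_sum]; exact sum_congr rfl fun x _ => by simp only [u]; push_cast; ring
    rw [e] at h
    norm_num at h
    have h' : ∑ x, ((u'' x : ℝ)) ^ 2 = 4096 := by linarith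
    exact_mod_cast h'
  have hZcard : #Z = 512 := by
    rw [hS, card_image_of_injective _ (fun a b h => by simpa using congrArg (bxor xZ) h), hcardV]
  have hcardV9 : #V₀ = 2 ^ 9 := by rw [hcardV]; norm_num
  have hxZ : xZ ∈ Z := by rw [hS]; exact mem_image.2 ⟨zeroVec, h0, bxor_zeroVec xZ⟩
  have hPV : ∀ x, x ∈ Z → ∀ a ∈ V₀, bxor x a ∈ Z := fun x hx a ha => fl1_coset_vadd hadd hS hx ha
  -- budget split: `Σ_Z e² ≥ 512`, so `Σ_{∉Z} e² + Σ_Z (e² − 1) ≤ 128`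
  have hon_le : ∑ x ∈ Z, (e x ^ 2 - 1) ≤ 128 := by
    rw [sum_sub_distrib, sum_const, nsmul_eq_mul, mul_one, hZcard]
    have h3 : 0 ≤ ∑ x ∈ univ.filter (fun x => x ∉ Z), e x ^ 2 := sum_nonneg fun x _ => sq_nonneg _
    push_cast
    linarith
  obtain ⟨H3, H4⟩ := tw6_H34_tol f g hf hg u'' hu'' V₀ xZ h0 hadd hcardV hS hoff8
  replace H3 : ∀ x ∈ Z, ∀ a b c : Fin (6 + 6) → Bool, a ∈ V₀ → b ∈ V₀ → c ∈ V₀ →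
      (4 : ℤ) ∣ ∑ ε : Fin 3 → Bool, e (fun j => x j ^^ decide (Odd #(univ.filter fun i =>
        ε i && (![a, b, c] : Fin 3 → Fin (6 + 6) → Bool) i j))) := H3
  replace H4 : ∀ x ∈ Z, ∀ a₀ a₁ a₂ a₃ : Fin (6 + 6) → Bool, a₀ ∈ V₀ → a₁ ∈ V₀ → a₂ ∈ V₀ → a₃ ∈ V₀ →
      (8 : ℤ) ∣ ∑ ε : Fin 4 → Bool, e (fun j => x j ^^ decide (Odd #(univ.filter fun i =>
        ε i && (![a₀, a₁, a₂, a₃] : Fin 4 → Fin (6 + 6) → Bool) i j))) := H4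

  -- the sign `σ = sZ ∘ hb ≡ e (mod 4)` and the wild part `λ = (e − σ)/4` on `Z`
  set hb : (Fin (6 + 6) → Bool) → Bool := fun x => decide (e x % 4 = 3) with hhb
  set lam : (Fin (6 + 6) → Bool) → ℤ := fun x => (e x - sZ (hb x)) / 4 with hlam
  have hdec : ∀ x, x ∈ Z → e x = sZ (hb x) + 4 * lam x := by
    intro x hx
    have h0 := Int.odd_iff.1 (heodd x hx)
    have hmod : e x % 4 = 1 ∨ e x % 4 = 3 := by omega
    have h4 : (4 : ℤ) ∣ e x - sZ (hb x) := by
      rcases hmod with h1 | h3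
      · have hsz : sZ (hb x) = 1 := by simp [hb, h1, sZ]
        rw [hsz]; omega
      · have hsz : sZ (hb x) = -1 := by simp [hb, h3, sZ]
        rw [hsz]; omega
    have := Int.mul_ediv_cancel' h4
    simp only [lam]
    linarith
  -- (H3) for the sign pattern and base-free second differences
  have H3σ : ∀ x, x ∈ Z → ∀ a b c : Fin (6 + 6) → Bool, a ∈ V₀ → b ∈ V₀ → c ∈ V₀ →
      (4 : ℤ) ∣ ∑ ε : Fin 3 → Bool, sZ (hb (fun j => x j ^^ decide (Odd #(univ.filter fun i =>
        ε i && (![a, b, c] : Fin 3 → Fin (6 + 6) → Bool) i j)))) := by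
    intro x hx a b c ha hb' hc
    have hin : ∀ ε : Fin 3 → Bool, (fun j => x j ^^ decide (Odd #(univ.filter fun i =>
        ε i && (![a, b, c] : Fin 3 → Fin (6 + 6) → Bool) i j))) ∈ Z :=
      fun ε => fr_mem_flatPt3 V₀ h0 (· ∈ Z) hPV hx ![a, b, c] (fun i => by fin_cases i <;> assumption) ε
    have h := H3 x hx a b c ha hb' hc
    rw [sum_congr rfl fun ε _ => hdec _ (hin ε), sum_add_distrib, ← mul_sum] at h
    obtain ⟨k, hk⟩ := h
    exact ⟨k - ∑ ε : Fin 3 → Bool, lam (fun j => x j ^^ decide (Odd #(univ.filter fun i =>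
        ε i && (![a, b, c] : Fin 3 → Fin (6 + 6) → Bool) i j))), by linarith⟩
  have hVP : ∀ x, x ∈ Z → bxor xZ x ∈ V₀ := fun x hx => fl1_coset_diff hS hx
  have hsd := fr_hsd V₀ (· ∈ Z) xZ hxZ hVP hb H3σ
  -- (H4) and the Pfaffian: the parity of a 4-flat sum of `λ` does not depend on the base point
  have hPf : ∀ x, x ∈ Z → ∀ a : Fin 4 → Fin (6 + 6) → Bool, (∀ i, a i ∈ V₀) →
      ((2 : ℤ) ∣ ∑ ε : Fin 4 → Bool, lam (fun j => x j ^^ decide (Odd #(univ.filter fun i => ε i && a i j))) ↔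
        ¬ ((((hb xZ ^^ hb (bxor xZ (a 1)) ^^ hb (bxor xZ (a 0)) ^^ hb (bxor (bxor xZ (a 1)) (a 0))) &&
            (hb xZ ^^ hb (bxor xZ (a 3)) ^^ hb (bxor xZ (a 2)) ^^ hb (bxor (bxor xZ (a 3)) (a 2)))) ^^
          ((hb xZ ^^ hb (bxor xZ (a 2)) ^^ hb (bxor xZ (a 0)) ^^ hb (bxor (bxor xZ (a 2)) (a 0))) &&
            (hb xZ ^^ hb (bxor xZ (a 3)) ^^ hb (bxor xZ (a 1)) ^^ hb (bxor (bxor xZ (a 3)) (a 1)))) ^^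
          ((hb xZ ^^ hb (bxor xZ (a 3)) ^^ hb (bxor xZ (a 0)) ^^ hb (bxor (bxor xZ (a 3)) (a 0))) &&
            (hb xZ ^^ hb (bxor xZ (a 2)) ^^ hb (bxor xZ (a 1)) ^^ hb (bxor (bxor xZ (a 2)) (a 1))))) = true)) := by
    intro x hx a ha
    have ea : a = ![a 0, a 1, a 2, a 3] := by funext i; fin_cases i <;> rfl
    have hin : ∀ ε : Fin 4 → Bool, (fun j => x j ^^ decide (Odd #(univ.filter fun i => ε i && a i j))) ∈ Z :=
      fun ε => fr_mem_flatPt4 V₀ h0 (· ∈ Z) hPV hx a ha ε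
    have h8 := H4 x hx (a 0) (a 1) (a 2) (a 3) (ha 0) (ha 1) (ha 2) (ha 3)
    rw [← ea] at h8
    rw [sum_congr rfl fun ε _ => hdec _ (hin ε), sum_add_distrib, ← mul_sum] at h8
    have hm8 := ws_sum4_mod8 V₀ (· ∈ Z) xZ hb hPV hsd hx (ha 0) (ha 1) (ha 2) (ha 3)
    rw [← ea] at hm8
    constructor
    · intro h2 hpf
      rw [if_pos hpf] at hm8
      obtain ⟨k, hk⟩ := h8
      obtain ⟨k2, hk2⟩ := h2
      omega
    · intro hpf
      rw [if_neg hpf] at hm8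
      obtain ⟨k, hk⟩ := h8
      exact ⟨k - (∑ ε : Fin 4 → Bool, sZ (hb (fun j => x j ^^ decide (Odd #(univ.filter fun i =>
        ε i && a i j))))) / 8, by omega⟩
  -- the odd set `L` of `λ` on `Z` has at most `7` points (each costs `e² − 1 ≥ 8`)
  set L := Z.filter (fun x => Odd (lam x)) with hLdef
  have hcost8 : ∀ x, x ∈ Z → Odd (lam x) → 8 ≤ e x ^ 2 - 1 := by
    intro x hx hodd
    have hd := hdec x hx
    have h0 := Int.odd_iff.1 hodd
    rcases tp_sZ_cases (hb x) with hs | hs <;> rw [hs] at hd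
    · have : e x ≤ -3 ∨ 3 ≤ e x := by omega
      have := tp_sq_ge (k := 3) (by norm_num) this; linarith
    · have : e x ≤ -3 ∨ 3 ≤ e x := by omega
      have := tp_sq_ge (k := 3) (by norm_num) this; linarith
  have hL7 : (#L : ℤ) ≤ 16 := by
    have h1 : ∑ x ∈ L, (8 : ℤ) ≤ ∑ x ∈ L, (e x ^ 2 - 1) :=
      sum_le_sum fun x hx => hcost8 x (mem_filter.1 hx).1 (mem_filter.1 hx).2
    have h2 : ∑ x ∈ L, (e x ^ 2 - 1) ≤ ∑ x ∈ Z, (e x ^ 2 - 1) :=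
      sum_le_sum_of_subset_of_nonneg (filter_subset _ _) (fun x hx _ => by have := hsq1 x hx; linarith)
    rw [sum_const, nsmul_eq_mul] at h1
    linarith
  -- every 4-flat sum of `λ` on `Z` is even (otherwise `Z` is covered by sixteen translates of `L`)
  have hLeven : ∀ x, x ∈ Z → ∀ a : Fin 4 → Fin (6 + 6) → Bool, (∀ i, a i ∈ V₀) →
      (2 : ℤ) ∣ ∑ ε : Fin 4 → Bool, lam (fun j => x j ^^ decide (Odd #(univ.filter fun i => ε i && a i j))) := by
    intro x hx a ha
    by_contra hodd
    have hPfa := fun hn => hodd ((hPf x hx a ha).2 hn)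
    have hall : ∀ y, y ∈ Z → ¬ (2 : ℤ) ∣ ∑ ε : Fin 4 → Bool, lam (fun j => y j ^^ decide (Odd #(univ.filter fun i =>
        ε i && a i j))) := fun y hy h2 => (hPf y hy a ha).1 h2 (not_not.1 hPfa)
    have hex : ∀ y, y ∈ Z → ∃ ε : Fin 4 → Bool, Odd (lam (fun j => y j ^^ decide (Odd #(univ.filter fun i =>
        ε i && a i j)))) := by
      intro y hy
      by_contra hnone
      push Not at hnone
      exact hall y hy (dvd_sum fun ε _ => even_iff_two_dvd.1 (Int.not_odd_iff_even.1 (hnone ε)))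
    have hv : ∀ ε : Fin 4 → Bool, (fun j => zeroVec j ^^ decide (Odd #(univ.filter fun i => ε i && a i j))) ∈ V₀ :=
      fun ε => ws_flatPt_mem V₀ h0 (· ∈ V₀) (fun y hy b hb' => hadd y hy b hb') 4 zeroVec h0 a ha ε
    have hcover : Z ⊆ (univ : Finset (Fin 4 → Bool)).biUnion (fun ε => Z.filter fun y =>
        Odd (lam (bxor y (fun j => zeroVec j ^^ decide (Odd #(univ.filter fun i => ε i && a i j)))))) := by
      intro y hy
      obtain ⟨ε, hε⟩ := hex y hy
      rw [ws_flatPt_eq_bxor] at hε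
      exact mem_biUnion.2 ⟨ε, mem_univ _, mem_filter.2 ⟨hy, hε⟩⟩
    have hcard := (card_le_card hcover).trans card_biUnion_le
    rw [sum_congr rfl fun ε _ => ws_card_translate V₀ Z xZ hadd hS (hv ε) (fun y => Odd (lam y)), sum_const, card_univ,
      Fintype.card_fun, Fintype.card_bool, Fintype.card_fin, smul_eq_mul, hZcard] at hcard
    have : (512 : ℤ) ≤ 16 * #L := by exact_mod_cast hcard
    linarith
  -- Reed–Muller on the coset: `λ` is even on `Z`
  have hlam_even : ∀ x, x ∈ Z → Even (lam x) := by
    rcases ws_erm_round V₀ h0 hadd hcardV9 xZ lam 3 (fun b hb' a ha => hLeven b (by rwa [hS]) a ha) with hev | hbig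
    · intro x hx; exact hev x (by rwa [← hS])
    · exfalso
      rw [← hS] at hbig
      have hbig' : 2 ^ 9 ≤ 2 ^ 3 * #L := hbig
      have : (64 : ℤ) ≤ #L := by exact_mod_cast (by norm_num at hbig'; omega)
      linarith
  -- (H4) for the sign pattern `σ = sZ ∘ hb` (now that `λ` is even), and the ENGINE
  have hσpm : ∀ x ∈ Z, sZ (hb x) = 1 ∨ sZ (hb x) = -1 := fun x _ => tp_sZ_cases _
  have H3σ' : ∀ x ∈ Z, ∀ a b c : Fin (6 + 6) → Bool, a ∈ V₀ → b ∈ V₀ → c ∈ V₀ →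
      (4 : ℤ) ∣ ∑ ε : Fin 3 → Bool, sZ (hb (fun j => x j ^^ decide (Odd #(univ.filter fun i =>
        ε i && (![a, b, c] : Fin 3 → Fin (6 + 6) → Bool) i j)))) := fun x hx a b c ha hb' hc => H3σ x hx a b c ha hb' hc
  have H4σ : ∀ x ∈ Z, ∀ a₀ a₁ a₂ a₃ : Fin (6 + 6) → Bool, a₀ ∈ V₀ → a₁ ∈ V₀ → a₂ ∈ V₀ → a₃ ∈ V₀ →
      (8 : ℤ) ∣ ∑ ε : Fin 4 → Bool, sZ (hb (fun j => x j ^^ decide (Odd #(univ.filter fun i =>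
        ε i && (![a₀, a₁, a₂, a₃] : Fin 4 → Fin (6 + 6) → Bool) i j)))) := by
    intro x hx a₀ a₁ a₂ a₃ ha₀ ha₁ ha₂ ha₃
    have hin : ∀ ε : Fin 4 → Bool, (fun j => x j ^^ decide (Odd #(univ.filter fun i =>
        ε i && (![a₀, a₁, a₂, a₃] : Fin 4 → Fin (6 + 6) → Bool) i j))) ∈ Z :=
      fun ε => fr_mem_flatPt4 V₀ h0 (· ∈ Z) hPV hx ![a₀, a₁, a₂, a₃] (fun i => by fin_cases i <;> assumption) ε
    have h8 := H4 x hx a₀ a₁ a₂ a₃ ha₀ ha₁ ha₂ ha₃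
    rw [sum_congr rfl fun ε _ => hdec _ (hin ε), sum_add_distrib, ← mul_sum] at h8
    have h2 : (2 : ℤ) ∣ ∑ ε : Fin 4 → Bool, lam (fun j => x j ^^ decide (Odd #(univ.filter fun i =>
        ε i && (![a₀, a₁, a₂, a₃] : Fin 4 → Fin (6 + 6) → Bool) i j))) :=
      dvd_sum fun ε _ => even_iff_two_dvd.1 (hlam_even _ (hin ε))
    obtain ⟨k, hk⟩ := h8
    obtain ⟨k2, hk2⟩ := h2
    exact ⟨k - k2, by linarith⟩
  have hE := fl1_flat_l1 V₀ Z xZ h0 hadd hS (fun x => sZ (hb x)) hσpm H3σ' H4σ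
  set A : (Fin (6 + 6) → Bool) → ℝ := fun x => if x ∈ Z then ((sZ (hb x) : ℤ) : ℝ) else 0 with hA
  have hl1 : ∑ y, |W A y| ≤ 8192 := by
    by_contra hgt
    push Not at hgt
    have hsq : (8192 : ℝ) ^ 2 < (∑ y, |W A y|) ^ 2 := pow_lt_pow_left₀ hgt (by norm_num) two_ne_zero
    norm_num at hE hsq
    linarith
  have hpairA := fl1_pairing g A
  have hAW : ∑ x, A x * W (fun y => signOf (g y)) x = 64 * ((∑ x ∈ Z, sZ (hb x) * u'' x : ℤ) : ℝ) := by
    have e1 : ∀ x, A x * W (fun y => signOf (g y)) x = if x ∈ Z then (((64 * (sZ (hb x) * u'' x) : ℤ)) : ℝ) else 0 := by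
      intro x
      simp only [A]
      split_ifs with hx
      · rw [hu'' x]; push_cast; ring
      · rw [zero_mul]
    rw [sum_congr rfl fun x _ => e1 x, sum_ite_mem, univ_inter]
    push_cast
    rw [mul_sum]
  have hσu : (∑ x ∈ Z, sZ (hb x) * u'' x : ℤ) ≤ 128 := by
    have h1 : ∑ y, signOf (g y) * W A y ≤ 8192 := (fl1_pairing_le_l1 g (W A)).trans hl1
    rw [hpairA, hAW] at h1
    have h2 : ((∑ x ∈ Z, sZ (hb x) * u'' x : ℤ) : ℝ) ≤ 128 := by linarith
    exact_mod_cast h2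
  -- integer bookkeeping: `Σ_x u'' s = (8192 − B)/2 ≥ 3812`, `Σ_{x∉Z} u'' s = 3584`, so `Σ_Z u'' s ≥ 228`
  have hs1 : ∀ x, sZ (f x) ^ 2 = 1 := fun x => by rcases tp_sZ_cases (f x) with h | h <;> rw [h] <;> norm_num
  have hus : 2 * ∑ x, u'' x * sZ (f x) = 8192 - ∑ x, e x ^ 2 := by
    have e1 : ∀ x, e x ^ 2 = u'' x ^ 2 - 2 * (u'' x * sZ (f x)) + 1 := fun x => by simp only [e]; nlinarith [hs1 x]
    rw [sum_congr rfl fun x _ => e1 x, sum_add_distrib, sum_sub_distrib, hpar, ← mul_sum, sum_const, card_univ, Fintype.card_fun,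
      Fintype.card_bool, Fintype.card_fin]
    norm_num
    ring
  have hsplit2 : ∑ x, u'' x * sZ (f x) = ∑ x ∈ Z, u'' x * sZ (f x) + ∑ x ∈ univ.filter (fun x => x ∉ Z), u'' x * sZ (f x) := by
    rw [← sum_filter_add_sum_filter_not univ (fun x => x ∈ Z)]
    congr 1
    exact sum_congr (by ext x; simp) fun _ _ => rfl
  have hoffus : 8 * ∑ x ∈ univ.filter (fun x => x ∉ Z), u'' x * sZ (f x) ≤
      8 * 3584 + ∑ x ∈ univ.filter (fun x => x ∉ Z), e x ^ 2 := by
    have e1 : ∀ x ∈ univ.filter (fun x => x ∉ Z), 8 * (u'' x * sZ (f x)) ≤ 8 + e x ^ 2 := by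
      intro x hx
      obtain ⟨k, hk⟩ := hoff8 x (mem_filter.1 hx).2
      have hk' : e x = 8 * k := hk
      have hu1 : u'' x = sZ (f x) + 8 * k := by have h0 := hk'; simp only [e] at h0; linarith
      rw [hu1]
      have h1 := tw6_pt_ineq2 (sZ (f x)) k (tp_sZ_cases _)
      have h2 : e x ^ 2 = (8 * k) ^ 2 := congrArg (· ^ 2) hk'
      linarith
    have h1 := sum_le_sum e1
    rw [← mul_sum, sum_add_distrib, sum_const, nsmul_eq_mul] at h1
    have hc : #(univ.filter fun x : Fin (6 + 6) → Bool => x ∉ Z) + #Z = 4096 := by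
      have h := Finset.card_filter_add_card_filter_not (s := (univ : Finset (Fin (6 + 6) → Bool))) (fun x => x ∉ Z)
      rw [card_univ, Fintype.card_fun, Fintype.card_bool, Fintype.card_fin] at h
      have e2 : (univ.filter fun x : Fin (6 + 6) → Bool => ¬ x ∉ Z) = Z := by ext x; simp
      rw [e2] at h
      norm_num at h
      exact h
    rw [hZcard] at hc
    have hc' : #(univ.filter fun x : Fin (6 + 6) → Bool => x ∉ Z) = 3584 := by omega
    rw [hc'] at h1
    push_cast at h1
    linarith
  -- pointwise on `Z`: `σu'' = u''s + 4λ(σ − s)` and `12λ(σ − s) + (e² − 1) ≥ 0` (λ even, |σ − s| ≤ 2)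
  have hpt : ∀ x ∈ Z, sZ (hb x) * u'' x = u'' x * sZ (f x) + 4 * (lam x * (sZ (hb x) - sZ (f x))) := by
    intro x hx
    have hd := hdec x hx
    have hu1 : u'' x = sZ (f x) + sZ (hb x) + 4 * lam x := by simp only [e] at hd; linarith
    have hb1 : sZ (hb x) ^ 2 = 1 := by rcases tp_sZ_cases (hb x) with h | h <;> rw [h] <;> norm_num
    rw [hu1]; nlinarith [hb1, hs1 x]
  have hineq : ∀ x ∈ Z, 0 ≤ 12 * (lam x * (sZ (hb x) - sZ (f x))) + (e x ^ 2 - 1) := by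
    intro x hx
    obtain ⟨k, hk⟩ := hlam_even x hx
    have hd := hdec x hx
    rw [hd, hk]
    exact tw6_pt_ineq _ _ k (tp_sZ_cases _) (tp_sZ_cases _)
  have hsum_pt : ∑ x ∈ Z, sZ (hb x) * u'' x = ∑ x ∈ Z, u'' x * sZ (f x) + 4 * ∑ x ∈ Z, lam x * (sZ (hb x) - sZ (f x)) := by
    rw [mul_sum, ← sum_add_distrib]; exact sum_congr rfl hpt
  have hsum_ineq : 0 ≤ 12 * ∑ x ∈ Z, lam x * (sZ (hb x) - sZ (f x)) + ∑ x ∈ Z, (e x ^ 2 - 1) := by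
    rw [mul_sum, ← sum_add_distrib]; exact sum_nonneg hineq
  -- `Σ_Z σu'' ≥ 256 − (5/6)·D_Z − (5/8)·B_off ≥ 150 > 128`
  have h3 : 3 * (4 * ∑ x ∈ Z, lam x * (sZ (hb x) - sZ (f x))) ≥ -(∑ x ∈ Z, (e x ^ 2 - 1)) := by linarith
  have hsplitZ : ∑ x ∈ Z, e x ^ 2 = 512 + ∑ x ∈ Z, (e x ^ 2 - 1) := by
    rw [sum_sub_distrib, sum_const, nsmul_eq_mul, mul_one, hZcard]; push_cast; ring
  linarith

end Summit.QuantumAdvantage.QuantumAdvantage.Theorems.CubicForrelation.NearExactIsExact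

end
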